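import Literature.Probability.RandomPlanarGeometry.SAWCountZdSymbolTopData
import HarnessLib

/-!
# The TOP shape classes of `R_j`, part 3: the bijection with the top data and the count `#shapeClass j (2j) (topVec p) = (2j−5)‼ · 2^{2j−2}`

Topic `Literature/Probability/RandomPlanarGeometry` (car λ «LEADING SHAPE COEFFICIENT», part 3 of 4; continues `SAWCountZdSymbolTopData.lean`).

PRINTED CONTEXT (locators only; nothing is quoted digit-for-digit). Madras–Slade (1993) §1.1 eq. (1.1.8) p. 5 (the `1/d` expansion of `μ` after
Fisher–Sykes / Fisher–Gaunt, "although there is no rigorous control of their error term"), Definition 1.2.4, §1.2 p. 10; Clisby–Liang–Slade (2007) §3.3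
eqs. (29)/(31) (enumerations decomposed by the number of dimensions explored). NOT IN PRINT as far as the lane's desks could locate (lit-1 g30 / lit-2 g31,
2026-08-27; FINDING-ZD-SYMBOL-POLYNOMIALITY §6(b)): the statements below (lane theorems about the lane's own symbol polynomial `R_j = symbolPoly j` of
`SAWCountZdSymbolPolynomiality.lean`, a-p1 g22, and its shape classes `shapeClass j u A` of `SAWCountZdRepeatSetShapes.lean`).

THE BIJECTION (this file). Forgetful map `κ ↦ (pairsOf p κ, signsOf p κ)` (the axis classes of the outside positions — a perfect matching by part 1's
"every axis twice" and `top_block` (`axCls_of_inB`, `axCls_subset_outside`, ★ `pairsOf_signsOf_mem_topData`) — and the positive free positions); ★ LEFT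
INVERSE `canon_mkWord_pairsOf_signsOf` (the rebuilt word has the type of `κ`, and `κ` is canonical) and ★ RIGHT INVERSE `pairsOf_signsOf_canon_mkWord`; hence
★★ `card_shapeClass_top_eq_card_topData` (`Finset.card_nbij'`), the data count ★ `card_topData` = `(2j−5)‼ · 2^{2j−2}` (`card_pairPartitions_of_card_eq_two_mul`
× `card_powerset`), and ★★★ `card_shapeClass_top`: `#shapeClass j (2j) (topVec (2j) p) = (2j−5)‼ · 2^{2j−2}` for EVERY block position `p` (`p + 4 ≤ 2j`) —
the per-position count `4, 16·1, 64·3, 256·15, …` predicted in FINDING-ZD-SYMBOL-POLYNOMIALITY §12 (e.g. `192 · 5 = 960 = M₄(8,5)`, `3 840 · 7 = 26 880 = M₅(10,7)`,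
`107 520 · 9 = 967 680 = M₆(12, 9)`, `3 870 720 · 11 = 42 577 920 = M₇(14, 11)` — the kernel censuses #883/#1026 and kit j291072).
Tool notions (the lane's): `pairsOf`, `signsOf`.

THIS FILE (lane «pcv-sawmu», a-p1 g25; all PROVED, standard axioms): `pairsOf`, `signsOf`, `axCls_eq_pair_of_mem`, `axCls_of_inB`, `axCls_subset_outside`,
★ `pairsOf_signsOf_mem_topData`, `pairsOf_mem_pairPartitions`, `blockOf_pairsOf`, ★ `canon_mkWord_pairsOf_signsOf`, `axCls_canon`, ★ `pairsOf_signsOf_canon_mkWord`,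
★★ `card_shapeClass_top_eq_card_topData`, `card_filter_inB`, `card_outside`, `card_freePos`, ★ `card_topData`, ★★★ `card_shapeClass_top`.
[cite: MadrasSlade1993, §1.1 eq. (1.1.8) p. 5; Definition 1.2.4; §1.2 (p. 10)] [cite: ClisbyLiangSlade2007, §3.3 eqs. (29)/(31)] [cite: GlimmJaffeQP1987, (3.2.13) §3.2]

Provenance: lane «pcv-sawmu», a-p1 g25 (2026-08-28).
-/

open Finset
open scoped BigOperators
open Literature.Probability.LatticeModels
open Literature.Probability.RandomPlanarGeometry.SAW
open Literature.Probability.Percolation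
open Literature.MathematicalPhysics.QuantumFieldTheory.Balaban1983to89

namespace Literature.Probability.RandomPlanarGeometry.SAW.Zd

namespace WordTypes

variable {m : ℕ}

section Forget

variable {p : ℕ}

open Classical in
/-- The matching of a top shape: the axis classes of its outside positions. [cite: MadrasSlade1993, Definition 1.2.4; lane tool notion] -/
noncomputable def pairsOf (p : ℕ) (κ : Word m m) : Finset (Finset (Fin m)) := (outside m p).image (axCls κ)

open Classical in
/-- The sign set of a top shape: the free positions carrying a positive sign. [cite: MadrasSlade1993, Definition 1.2.4; lane tool notion] -/
def signsOf (p : ℕ) (κ : Word m m) : Finset (Fin m) := (freePos m p).filter fun q => (κ q).2 = true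

/-- An axis class with two known distinct members is that pair. [cite: MadrasSlade1993, Definition 1.2.4; lane plumbing] -/
theorem axCls_eq_pair_of_mem {j : ℕ} (hm : m = 2 * j) {A : Fin m → Bool} {κ : Word m m} (hκ : κ ∈ shapeClass j m A)
    {q q' : Fin m} (hq' : q' ∈ axCls κ q) (hne : q' ≠ q) : axCls κ q = {q, q'} := by
  classical
  obtain ⟨r, hr, hcls⟩ := exists_axCls_eq_pair hm hκ q
  rw [hcls] at hq' ⊢
  rw [Finset.mem_insert, Finset.mem_singleton] at hq'
  rcases hq' with h | h
  · exact absurd h hne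
  · rw [h]

open Classical in
/-- In a top shape class the axis class of a block position is its parity class inside the block.
[cite: MadrasSlade1993, Definition 1.2.4; lane lemma] -/
theorem axCls_of_inB {j : ℕ} (hm : m = 2 * j) {κ : Word m m} (hκ : κ ∈ shapeClass j m (topVec m p)) (hp : p + 4 ≤ m)
    {q : Fin m} (hq : InB p q) :
    axCls κ q = Finset.univ.filter fun r : Fin m => InB p r ∧ (r.val - p) % 2 = (q.val - p) % 2 := by
  obtain ⟨h2, h3, -⟩ := top_block hm hκ hp
  have key0 : axCls κ ⟨p, by omega⟩ = {⟨p, by omega⟩, ⟨p + 2, by omega⟩} :=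
    axCls_eq_pair_of_mem hm hκ (mem_axCls.2 (by rw [h2])) (by simp)
  have key1 : axCls κ ⟨p + 1, by omega⟩ = {⟨p + 1, by omega⟩, ⟨p + 3, by omega⟩} :=
    axCls_eq_pair_of_mem hm hκ (mem_axCls.2 (by rw [h3])) (by simp)
  have key2 : axCls κ ⟨p + 2, by omega⟩ = {⟨p, by omega⟩, ⟨p + 2, by omega⟩} := by
    rw [← key0]; exact axCls_eq_of_mem (mem_axCls.2 (by rw [h2]))
  have key3 : axCls κ ⟨p + 3, by omega⟩ = {⟨p + 1, by omega⟩, ⟨p + 3, by omega⟩} := by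
    rw [← key1]; exact axCls_eq_of_mem (mem_axCls.2 (by rw [h3]))
  have hcases : q = ⟨p, by omega⟩ ∨ q = ⟨p + 1, by omega⟩ ∨ q = ⟨p + 2, by omega⟩ ∨ q = ⟨p + 3, by omega⟩ := by
    unfold InB at hq; simp only [Fin.ext_iff]; omega
  ext r
  simp only [Finset.mem_filter, Finset.mem_univ, true_and]
  unfold InB
  rcases hcases with rfl | rfl | rfl | rfl
  · rw [key0]; simp only [Finset.mem_insert, Finset.mem_singleton, Fin.ext_iff]; omega
  · rw [key1]; simp only [Finset.mem_insert, Finset.mem_singleton, Fin.ext_iff]; omega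
  · rw [key2]; simp only [Finset.mem_insert, Finset.mem_singleton, Fin.ext_iff]; omega
  · rw [key3]; simp only [Finset.mem_insert, Finset.mem_singleton, Fin.ext_iff]; omega

/-- In a top shape class the axis class of an outside position lies outside the block. [cite: MadrasSlade1993, Definition 1.2.4; lane lemma] -/
theorem axCls_subset_outside {j : ℕ} (hm : m = 2 * j) {κ : Word m m} (hκ : κ ∈ shapeClass j m (topVec m p)) (hp : p + 4 ≤ m)
    {q : Fin m} (hq : ¬ InB p q) : axCls κ q ⊆ outside m p := by
  classical
  intro r hr
  rw [mem_outside]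
  intro hrB
  have hqr : q ∈ axCls κ r := by rw [axCls_eq_of_mem hr]; exact self_mem_axCls κ q
  rw [axCls_of_inB hm hκ hp hrB, Finset.mem_filter] at hqr
  exact hq hqr.2.1

/-- ★ The forgetful map lands in the top data: the outside axis classes form a perfect matching of the outside positions, and the sign
set lies in the free positions. [cite: MadrasSlade1993, Definition 1.2.4; lane lemma] -/
theorem pairsOf_signsOf_mem_topData {j : ℕ} (hm : m = 2 * j) {κ : Word m m} (hκ : κ ∈ shapeClass j m (topVec m p)) (hp : p + 4 ≤ m) :
    (pairsOf p κ, signsOf p κ) ∈ topData m p := by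
  classical
  unfold topData
  rw [Finset.mem_product]
  refine ⟨?_, Finset.mem_powerset.2 (Finset.filter_subset _ _)⟩
  rw [HiggsFluctMeasureWickPairings.mem_pairPartitions]
  refine ⟨⟨fun P hP => ?_, fun h => ?_, fun v hv => ?_, fun P hP Q hQ v hvP hvQ => ?_⟩, fun P hP => ?_⟩
  · obtain ⟨q, hq, rfl⟩ := Finset.mem_image.1 hP
    exact axCls_subset_outside hm hκ hp (mem_outside.1 hq)
  · obtain ⟨q, -, hq⟩ := Finset.mem_image.1 h
    exact Finset.notMem_empty q (hq ▸ self_mem_axCls κ q)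
  · exact ⟨axCls κ v, Finset.mem_image_of_mem _ hv, self_mem_axCls κ v⟩
  · obtain ⟨a, -, rfl⟩ := Finset.mem_image.1 hP
    obtain ⟨b, -, rfl⟩ := Finset.mem_image.1 hQ
    rw [← axCls_eq_of_mem hvP, ← axCls_eq_of_mem hvQ]
  · obtain ⟨q, -, rfl⟩ := Finset.mem_image.1 hP
    exact card_axCls_eq_two hm hκ q

/-- The matching of a top shape is a perfect matching of the outside positions. [cite: MadrasSlade1993, Definition 1.2.4; lane plumbing] -/
theorem pairsOf_mem_pairPartitions {j : ℕ} (hm : m = 2 * j) {κ : Word m m} (hκ : κ ∈ shapeClass j m (topVec m p))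
    (hp : p + 4 ≤ m) : pairsOf p κ ∈ HiggsFluctMeasureWickPairings.pairPartitions (outside m p) := by
  have h := pairsOf_signsOf_mem_topData hm hκ hp
  unfold topData at h
  exact (Finset.mem_product.1 h).1

/-- For a top shape `κ` and an outside position `q`, the block of `q` in `pairsOf κ` is its axis class.
[cite: MadrasSlade1993, Definition 1.2.4; lane plumbing] -/
theorem blockOf_pairsOf {j : ℕ} (hm : m = 2 * j) {κ : Word m m} (hκ : κ ∈ shapeClass j m (topVec m p)) (hp : p + 4 ≤ m)
    {q : Fin m} (hq : ¬ InB p q) : blockOf (pairsOf p κ) q = axCls κ q := by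
  classical
  have h := pairsOf_mem_pairPartitions hm hκ hp
  rw [HiggsFluctMeasureWickPairings.mem_pairPartitions] at h
  exact h.1.eq_blockOf (Finset.mem_image_of_mem _ (mem_outside.2 hq)) (self_mem_axCls κ q)

/-- ★ LEFT INVERSE: rebuilding from the matching and the signs of a top shape gives the shape back.
[cite: MadrasSlade1993, Definition 1.2.4; lane lemma] -/
theorem canon_mkWord_pairsOf_signsOf {j : ℕ} (hm : m = 2 * j) {κ : Word m m} (hκ : κ ∈ shapeClass j m (topVec m p))
    (hp : p + 4 ≤ m) : canon (mkWord hp (pairsOf p κ) (signsOf p κ)) = κ := by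
  classical
  have hcan : canon κ = κ := by
    unfold shapeClass at hκ
    simp only [Finset.mem_filter, Finset.mem_univ, true_and] at hκ
    exact hκ.1
  have hπ := pairsOf_mem_pairPartitions hm hκ hp
  obtain ⟨h2, h3, -⟩ := top_block hm hκ hp
  have hst : SameType (mkWord hp (pairsOf p κ) (signsOf p κ)) κ := by
    refine ⟨fun q q' => ?_, fun q => ?_⟩
    · change axisOf hp (pairsOf p κ) q = axisOf hp (pairsOf p κ) q' ↔ _
      rw [axisOf_eq_iff hp hπ]
      have hmem : (κ q).1 = (κ q').1 ↔ q ∈ axCls κ q' := mem_axCls.symm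
      rw [hmem]
      by_cases hq : InB p q <;> by_cases hq' : InB p q'
      · rw [axCls_of_inB hm hκ hp hq', Finset.mem_filter]
        simp only [hq, hq', true_and, not_true_eq_false, false_and, or_false, Finset.mem_univ]
      · refine iff_of_false ?_ fun h => hq' ?_
        · rintro (⟨-, h, -⟩ | ⟨h, -, -⟩)
          · exact hq' h
          · exact h hq
        · exact absurd hq (mem_outside.1 (axCls_subset_outside hm hκ hp hq' h))
      · refine iff_of_false ?_ fun h => hq ?_
        · rintro (⟨h, -, -⟩ | ⟨-, h, -⟩)
          · exact hq h
          · exact h hq'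
        · rw [axCls_of_inB hm hκ hp hq', Finset.mem_filter] at h
          exact h.2.1
      · rw [blockOf_pairsOf hm hκ hp hq, blockOf_pairsOf hm hκ hp hq']
        simp only [hq, hq', not_false_eq_true, true_and, false_and, false_or]
        constructor
        · intro h; rw [← h]; exact self_mem_axCls κ q
        · intro h; rw [axCls_eq_of_mem h]
    · change signOf hp (signsOf p κ) q = (κ q).2
      unfold signOf signsOf freePos
      by_cases e2 : q.val = p + 2
      · rw [if_pos e2]
        have hq : q = ⟨p + 2, by omega⟩ := Fin.ext e2
        rw [hq, h2]
        simp
      · by_cases e3 : q.val = p + 3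
        · rw [if_neg e2, if_pos e3]
          have hq : q = ⟨p + 3, by omega⟩ := Fin.ext e3
          rw [hq, h3]
          simp
        · rw [if_neg e2, if_neg e3]
          simp [e2, e3]
  rw [hst.canon_eq, hcan]

end Forget

section Count

variable {p : ℕ}

/-- Canonical renaming keeps the axis classes. [cite: MadrasSlade1993, Definition 1.2.4; lane plumbing] -/
theorem axCls_canon (w : Word m m) (q : Fin m) : axCls (canon w) q = axCls w q := by
  ext r
  rw [mem_axCls, mem_axCls]
  exact ((sameType_canon w).1 r q).symm

/-- ★ RIGHT INVERSE: the matching and the sign set are read back off the built word.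
[cite: MadrasSlade1993, Definition 1.2.4; lane lemma] -/
theorem pairsOf_signsOf_canon_mkWord (hp : p + 4 ≤ m) {d : Finset (Finset (Fin m)) × Finset (Fin m)} (hd : d ∈ topData m p) :
    (pairsOf p (canon (mkWord hp d.1 d.2)), signsOf p (canon (mkWord hp d.1 d.2))) = d := by
  classical
  obtain ⟨π, S⟩ := d
  unfold topData at hd
  obtain ⟨hπ, hS⟩ := Finset.mem_product.1 hd
  rw [Finset.mem_powerset] at hS
  simp only
  refine Prod.ext ?_ ?_
  · -- the matching
    simp only
    unfold pairsOf
    rw [Finset.image_congr (fun q _ => axCls_canon (mkWord hp π S) q)]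
    have hπ' := hπ
    rw [HiggsFluctMeasureWickPairings.mem_pairPartitions] at hπ'
    ext P
    rw [Finset.mem_image]
    constructor
    · rintro ⟨q, hq, rfl⟩
      rw [axCls_mkWord hp hπ S q, if_neg (mem_outside.1 hq)]
      exact (blockOf_facts hπ (mem_outside.1 hq)).1
    · intro hP
      obtain ⟨v, hv⟩ := hπ'.1.nonempty_of_mem hP
      have hvO : v ∈ outside m p := hπ'.1.subset hP hv
      refine ⟨v, hvO, ?_⟩
      rw [axCls_mkWord hp hπ S v, if_neg (mem_outside.1 hvO)]
      exact hπ'.1.eq_blockOf hP hv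
  · -- the signs
    simp only
    unfold signsOf
    ext q
    rw [Finset.mem_filter]
    change q ∈ freePos m p ∧ signOf hp S q = true ↔ q ∈ S
    constructor
    · rintro ⟨hq, h⟩
      unfold freePos at hq
      rw [Finset.mem_filter] at hq
      unfold signOf at h
      rw [if_neg hq.2.1, if_neg hq.2.2] at h
      simpa using h
    · intro hq
      have hqf := hS hq
      refine ⟨hqf, ?_⟩
      unfold freePos at hqf
      rw [Finset.mem_filter] at hqf
      unfold signOf
      rw [if_neg hqf.2.1, if_neg hqf.2.2]
      simpa using hq

/-- ★★ THE TOP SHAPE CLASS IS IN BIJECTION WITH THE TOP DATA: `#shapeClass j (2j) (topVec p) = #topData (2j) p`.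
[cite: MadrasSlade1993, Definition 1.2.4; lane theorem] -/
theorem card_shapeClass_top_eq_card_topData {j : ℕ} (hm : m = 2 * j) (hp : p + 4 ≤ m) :
    (shapeClass j m (topVec m p)).card = (topData m p).card :=
  Finset.card_nbij' (fun κ => (pairsOf p κ, signsOf p κ)) (fun d => canon (mkWord hp d.1 d.2))
    (fun κ hκ => pairsOf_signsOf_mem_topData hm hκ hp)
    (fun d hd => canon_mkWord_mem_shapeClass hm hp (by unfold topData at hd; exact (Finset.mem_product.1 hd).1) d.2)
    (fun κ hκ => canon_mkWord_pairsOf_signsOf hm hκ hp)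
    (fun d hd => pairsOf_signsOf_canon_mkWord hp hd)

open Classical in
/-- The block has four positions. [cite: MadrasSlade1993, Definition 1.2.4; lane plumbing] -/
theorem card_filter_inB (hp : p + 4 ≤ m) : (Finset.univ.filter fun q : Fin m => InB p q).card = 4 := by
  have h : (Finset.univ.filter fun q : Fin m => InB p q) =
      ({⟨p, by omega⟩, ⟨p + 1, by omega⟩, ⟨p + 2, by omega⟩, ⟨p + 3, by omega⟩} : Finset (Fin m)) := by
    ext q
    unfold InB
    simp only [Finset.mem_filter, Finset.mem_univ, true_and, Finset.mem_insert, Finset.mem_singleton, Fin.ext_iff]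
    omega
  rw [h, Finset.card_insert_of_notMem (by simp [Fin.ext_iff]), Finset.card_insert_of_notMem (by simp [Fin.ext_iff]),
    Finset.card_pair (by simp [Fin.ext_iff])]

open Classical in
/-- `#outside = m − 4`. [cite: MadrasSlade1993, Definition 1.2.4; lane plumbing] -/
theorem card_outside (hp : p + 4 ≤ m) : (outside m p).card = m - 4 := by
  have h := Finset.card_filter_add_card_filter_not (s := (Finset.univ : Finset (Fin m))) (fun q : Fin m => InB p q)
  rw [card_filter_inB hp, Finset.card_univ, Fintype.card_fin] at h
  unfold outside
  omega

open Classical in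
/-- `#freePos = m − 2`. [cite: MadrasSlade1993, Definition 1.2.4; lane plumbing] -/
theorem card_freePos (hp : p + 4 ≤ m) : (freePos m p).card = m - 2 := by
  have h2 : (Finset.univ.filter fun q : Fin m => ¬ (q.val ≠ p + 2 ∧ q.val ≠ p + 3)).card = 2 := by
    have h : (Finset.univ.filter fun q : Fin m => ¬ (q.val ≠ p + 2 ∧ q.val ≠ p + 3)) =
        ({⟨p + 2, by omega⟩, ⟨p + 3, by omega⟩} : Finset (Fin m)) := by
      ext q
      simp only [Finset.mem_filter, Finset.mem_univ, true_and, Finset.mem_insert, Finset.mem_singleton, Fin.ext_iff]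
      omega
    rw [h, Finset.card_pair (by simp [Fin.ext_iff])]
  have h := Finset.card_filter_add_card_filter_not (s := (Finset.univ : Finset (Fin m)))
    (fun q : Fin m => q.val ≠ p + 2 ∧ q.val ≠ p + 3)
  rw [h2, Finset.card_univ, Fintype.card_fin] at h
  unfold freePos
  omega

/-- ★ THE TOP DATA COUNT: `#topData (2j) p = (2j−5)‼ · 2^{2j−2}` — `(2j−5)‼` perfect matchings of the `2j − 4` outside positions
(`card_pairPartitions`, Glimm–Jaffe (3.2.13)) times `2^{2j−2}` free signs. [cite: MadrasSlade1993, Definition 1.2.4; lane theorem] -/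
theorem card_topData {j : ℕ} (hm : m = 2 * j) (hp : p + 4 ≤ m) : (topData m p).card = (2 * j - 5).doubleFactorial * 2 ^ (2 * j - 2) := by
  unfold topData
  rw [Finset.card_product, Finset.card_powerset, card_freePos hp,
    HiggsFluctMeasureWickPairings.card_pairPartitions_of_card_eq_two_mul (n := j - 2) (by rw [card_outside hp]; omega)]
  have e1 : 2 * (j - 2) - 1 = 2 * j - 5 := by omega
  rw [e1, hm]

/-- ★★★ THE TOP SHAPE CLASS COUNT: `#shapeClass j (2j) (topVec (2j) p) = (2j−5)‼ · 2^{2j−2}` for every `p` with `p + 4 ≤ 2j` (independent of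
the position `p` of the block). [cite: MadrasSlade1993, Definition 1.2.4; lane theorem] -/
theorem card_shapeClass_top {j p : ℕ} (hp : p + 4 ≤ 2 * j) :
    (shapeClass j (2 * j) (topVec (2 * j) p)).card = (2 * j - 5).doubleFactorial * 2 ^ (2 * j - 2) := by
  rw [card_shapeClass_top_eq_card_topData rfl hp, card_topData rfl hp]

end Count

end WordTypes

end Literature.Probability.RandomPlanarGeometry.SAW.Zd
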